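import Summits.Langlands.Langlands.Theses.QuadraticWindow
import Summits.Langlands.Langlands.Theorems.TwistUnpackaging.Negative.PolarizedShadow
import Summits.Langlands.Langlands.Theorems.TwistUnpackaging.Negative.ExponentBoundedFamily
import Summits.Langlands.Langlands.Theorems.TwistUnpackaging.Negative.DetRescueClassification
import Summits.Langlands.Langlands.Theorems.TwistUnpackaging.Negative.CyclicTwistUnscrewingFalse
import Summits.Langlands.Langlands.Theorems.TwistUnpackaging.Negative.CoherentCubicFamily
import Summits.Langlands.Langlands.Theorems.TwistUnpackaging.Negative.StubAdmissiblePowersFalse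
import Literature.NumberTheory.Automorphic.AutomorphicRepsGLSatakeFlathProofs

/-!
# Disproof of `TwistUnpackaging` (stmt-Langlands-10903) — standing disprover's work file

Crux: `Summit.Langlands.Langlands.Theses.QuadraticWindow.TwistUnpackaging` (route QuadraticWindow,
rank 4): from the CONTROLLED family of induced packages `R_ψ : Γ_{F₀} → GL_{2n}(ℚ̄_ℓ)` (one for every
admissible finite-order twist `ψ` of the quadratic `F/F₀`) extract `ρ_π : Γ_F → GL_n(ℚ̄_ℓ)` with
COFINITE Satake–Frobenius matching.

**cdisprove gen 4, cycle 4** (2026-08-16). VERDICT SO FAR: no kill OF THE CRUX (it is implied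
verbatim by the target `QuadraticWindowA`, §0, hence unrefutable short of `¬ QuadraticWindowA`,
a consequence of the summit's conjunct (A) for genuine `π`); ONE TARGET KILLED: stub B
(`stub_admissiblePowers`) of the registered skeleton `Lines/kummer-chebotarev-separating-twists.lean`
is FALSE as typed (rank `n = 0`; Negative VIII, §10), repair `0 < n`; the other five stubs survive
the cheap attacks with the verdicts recorded in §10. What this file offers is NEGATIVE KNOWLEDGE
for provers/ideators: which hypotheses are load-bearing, which natural strengthenings are false,
where the printed `n = 2` devices stop working, and which stubs of the picked line hold water.

## Provenance (read me first)
The gen-1/gen-2 text of this file (cycle 2 v5, 883 lines, 2026-08-15T23:34:48Z) was attached as item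
evidence only (`run/gate/evidence/…`, not mounted on seats since the 08-14 maintenance) and never
published to `Cruxes/TwistUnpackaging/`; it is unreadable from this seat. Its CONCLUSIVE content is
LANDED and imported here —
* Negative I  `…Theorems.TwistUnpackaging.Negative.TwistSeparationOrder` (p69483): `separates_iff`
  (per-place cofinite step settled in every rank: one controlled twist of ratio `t` separates iff
  `orderOf t = 0 ∨ n < orderOf t`), `not_separates_one`, `separates_two_twists`, `inert_halving`;
* Negative II `…Negative.ControlLoadBearing` (p70157): `diagonal_adversary`,
  `extractionWithoutControl_false` (uncontrolled rev ≤ 2 shadow false in rank 2) vs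
  `extractionWithControl_holds`; `rank_two_det_rescue`, `rank_two_neg_one_swap` (Berger–Harcos §6);
* Negative III `…Negative.PolarizedShadow` (p70368): `extractionWithoutControlPolarized_false`
  (control load-bearing even with `hpol` hard-wired);
and its non-landed sections (§0 target ⇒ crux, §1 `n = 0` vacuity, §2 Core / Abstract forms with
glue, §2c family non-vacuity) are RE-DERIVED below from the item's evidence notes. Nothing restarted.

## Findings index
* §0 `crux_of_target` — X ⇒ crux verbatim: unrefutable short of `¬ QuadraticWindowA`.
* §1 `notTauInvariant_rank_zero_false` — the `n = 0` slice is vacuous (`hnti` unsatisfiable).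
* §2 `TwistUnpackagingCore`, `crux_of_core` — `IsTotallyReal F₀`, `(e, k)`, `hreg`, `hpol`, `hpar`,
  `hodd`, `ℓ ∤ disc F`, `π unramified above ℓ` are NOT used by the extraction (no
  `_false_without_` theorem is possible for them: Core ⇒ crux); load-bearing: `[F:F₀] = 2` + `τ`,
  `hnti` (only to make `ψ = 1` admissible), `hfam`.
* §2b `AbstractTwistUnpackaging`, `core_of_abstract` — the reviewer's abstract form over a.e.-defined
  Satake-type data `(D, a)` (no automorphic content; refutable in principle, not refuted), glued to
  Core through the PROVED `hasSatakeParamAt_unique_holds` / `hasSatakeParamAt_cofinite_holds`.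
  Prover chain: Abstract → Core → crux.
* §2c `trivialTwist_admissible` — `hfam` is not vacuous: `ψ = 1` is admissible under `hnti`.
* §3–§5 — imported Negative I–III (see Provenance).
* §6 NEW (cycle 3):
  (a) `SeparatesFamily`, `orbit_swap_powers`, `not_separatesFamily_rootsOfUnity` — a twist family of
      bounded EXPONENT `d ≤ n` is fooled at every place simultaneously (all of `μ_d` at once); so
      "all quadratic twists" (Taylor 1994 / Berger–Harcos 2007 / Mok 2014, `n = d = 2`) can never
      close the cofinite step in rank `n ≥ 2`; LANDED as Negative IV `…Negative.ExponentBoundedFamily`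
      (p70982, commit 824f4f807396);
  (b) `odd_part_eq`, `det_rescue_rank_three`, `not_detRescue_of_four_le`, `not_detRescue_four_pure`
      — the DETERMINANT RESCUE of Berger–Harcos §6 (quadratic twists + central character) extends to
      rank 3 and FAILS from rank 4 on, also for pure data; LANDED as Negative V
      `…Negative.DetRescueBoundary` (p71082, commit 6e2e63bd8c32).
  (c) Negative VI `…Negative.DetRescueClassification` (p71371, LANDED, imported):
      `detRescue_iff : DetRescue n ↔ n ≤ 3`.
  (d) Negative VII `…Negative.CyclicTwistUnscrewingFalse` (p71612, LANDED, imported): the crux idea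
      `prime-order-cyclic-unscrewing`'s first lemma `CyclicTwistUnscrewing` is FALSE AS TYPED
      (`χ = 1` allowed; `S₃`/standard-representation witness, Lean-checked); repair: `χ` of exact
      order `p`. Tree note `Cruxes/TwistUnpackaging/NegativeNote-CyclicTwistUnscrewing.md`.
* §10 NEW (cycle 4) — TARGETS = the six stubs of skeleton `e396fa773a0d`:
  (a) Negative VIII(b) `…Negative.StubAdmissiblePowersFalse` (p73706, LANDED, imported; the two
      shadow statements `StubAdmissiblePowers` (verbatim stub B) and `CoherentFamiliesTauInvariant`
      were relocated by the gate to `Literature.Uncategorized.StubAdmissiblePowers`, p73705):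
      `stubAdmissiblePowers_false : ¬ StubAdmissiblePowers` — stub B is FALSE at rank `n = 0`
      (GL_0 cuspidal datum `nonempty_cuspidalAutomorphicRepData_zero` + the Kummer family below);
      reduction `coherentFamiliesTauInvariant_of_stubB`; REPAIR: add `0 < n` (free from `hnti`);
  (b) Negative VIII(a) `…Negative.CoherentCubicFamily` (p72809, LANDED, imported):
      `exists_coherentFamily_not_tauInvariant` (a coherent cubic family over `ℚ(ζ₃)/ℚ` that is
      NOT `τ`-invariant: Kummer character of `∛2`), `outerConj_smul_kummerRoot` (Kummer conjugation
      lemma: `σα = uα ⇒ (θ_t σ)α = (t̄u)α`), `inflate_kummer_apply_coe`, `rat_pow_three_ne_four`;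
  (c) paper verdicts, stubs A, C, D, E, F: survive (details and prover-relevant observations in
      the §10 docstrings: tag recovery for D, the finite-candidate compactness for E, the inert
      Frobenius transport for F, the verified twist convention of C).
* §7 attack log (cycles 1–4, 27 attacks) and WHY IT RESISTS.  §8 next regimes.  §9 HANDOFF.
-/

set_option linter.dupNamespace false

namespace Summit.Langlands.Langlands.Cruxes.TwistUnpackaging.Disproof

open Summit.Langlands.Langlands.Theses.QuadraticWindow
open Summit.Langlands.Langlands.Theorems.TwistUnpackaging.Negative
open Literature.NumberTheory.Automorphic Literature.NumberTheory.GaloisRepresentations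
open NumberField IsDedekindDomain

/-! ## §0 Target ⇒ crux (the crux is implied verbatim by X) -/

/-- **X ⇒ crux.** `TwistUnpackaging` is `QuadraticWindowA` with one extra hypothesis (`hfam`);
dropping it gives the target verbatim. Hence the crux is unrefutable short of `¬ QuadraticWindowA`,
itself a consequence of the summit's conjunct (A) for genuine `π` (route header). [folklore] -/
theorem crux_of_target (hX : QuadraticWindowA) : TwistUnpackaging :=
  fun F₀ F _ _ _ _ _ τ hTR hdeg hτ n hcpt π e k hreg hpol hpar hodd hnti ℓ _ ι hℓ hunr _hfam =>
    hX F₀ F τ hTR hdeg hτ n hcpt π e k hreg hpol hpar hodd hnti ℓ ι hℓ hunr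

/-! ## §1 The rank-0 slice is vacuous -/

/-- **`n = 0`: `hnti` is unsatisfiable** (Satake parameters have `card = n = 0`, so `β = α = 0`).
The crux at `n = 0` is therefore vacuously true — cosmetic, the summit has `0 < n`. [folklore] -/
theorem notTauInvariant_rank_zero_false {F₀ F : Type} [Field F₀] [NumberField F₀] [Field F]
    [NumberField F] [Algebra F₀ F] (τ : F ≃ₐ[F₀] F)
    {hcpt : isCompact_glFiniteIntegralLevel 0 F} (π : CuspidalAutomorphicRepData 0 F hcpt) :
    ¬ (∃ᶠ w in Filter.cofinite, ∃ α β : Multiset ℂ,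
        π.1.HasSatakeParamAt w α ∧ π.1.HasSatakeParamAt (τ • w) β ∧ β ≠ α) := by
  intro h
  apply h
  refine Filter.Eventually.of_forall fun w => ?_
  rintro ⟨α, β, hα, hβ, hne⟩
  exact hne (by rw [Multiset.card_eq_zero.1 hβ.card_eq, Multiset.card_eq_zero.1 hα.card_eq])

/-! ## §2 The Core form: eight hypotheses are decoration for the extraction -/

section Core

variable (F₀ F : Type) [Field F₀] [NumberField F₀] [Field F] [NumberField F] [Algebra F₀ F]
  (τ : F ≃ₐ[F₀] F) (n : ℕ) (hcpt : isCompact_glFiniteIntegralLevel n F)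
  (π : CuspidalAutomorphicRepData n F hcpt) (ℓ : ℕ) [Fact ℓ.Prime] (ι : PadicAlgCl ℓ ≃+* ℂ)

/-- The CONTROLLED twist-family hypothesis `hfam` of the crux, verbatim, as a named predicate of
`(F₀, F, τ, n, π, ℓ, ι)`. [folklore] -/
def Family : Prop :=
  ∀ eψ : FramedGaloisRep F ℂ 1,
    (∀ w : HeightOneSpectrum (𝓞 F), ((ℓ : ℕ) : 𝓞 F) ∈ w.asIdeal → eψ.IsUnramifiedAt w) →
    (∀ (φ : F →+* ℝ) (c c' : Field.absoluteGaloisGroup F), IsComplexConjugation φ c →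
      IsComplexConjugation (φ.comp (τ : F →+* F)) c' →
      Matrix.GeneralLinearGroup.det (eψ c) = Matrix.GeneralLinearGroup.det (eψ c')) →
    (∃ᶠ w in Filter.cofinite, ∃ (α β : Multiset ℂ) (c c' : ℂ), π.1.HasSatakeParamAt w α ∧
      π.1.HasSatakeParamAt (τ • w) β ∧ eψ.HasFrobCharpolyAt w (Polynomial.X - Polynomial.C c) ∧
      eψ.HasFrobCharpolyAt (τ • w) (Polynomial.X - Polynomial.C c') ∧
      β.map (fun b ↦ b * c') ≠ α.map (fun a ↦ a * c)) →
    ∃ R : FramedGaloisRep F₀ (PadicAlgCl ℓ) (2 * n), R.toGaloisRep.IsSemisimple ∧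
      ∀ (v : HeightOneSpectrum (𝓞 F₀)) (α : _ → Multiset ℂ) (c : _ → ℂ),
        ((ℓ : ℕ) : 𝓞 F₀) ∉ v.asIdeal →
        (∀ w : HeightOneSpectrum (𝓞 F), w.under (𝓞 F₀) = v →
          w.asIdeal.ramificationIdx (𝓞 F₀) = 1 ∧ π.1.HasSatakeParamAt w (α w) ∧
          eψ.IsUnramifiedAt w ∧ eψ.HasFrobCharpolyAt w (Polynomial.X - Polynomial.C (c w))) →
        R.IsUnramifiedAt v ∧ R.HasFrobCharpolyAt v
          (∏ᶠ w ∈ {w : HeightOneSpectrum (𝓞 F) | w.under (𝓞 F₀) = v},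
            Polynomial.expand (PadicAlgCl ℓ) (w.asIdeal.inertiaDeg (𝓞 F₀))
              (arithFrobPolyOfSatake ι w.residueCard n ((α w).map (fun a ↦ a * c w))))

/-- The conclusion of the crux, verbatim, as a named predicate of `(F, n, π, ℓ, ι)`. [folklore] -/
def Conclusion : Prop :=
  ∃ ρ : FramedGaloisRep F (PadicAlgCl ℓ) n, ρ.toGaloisRep.IsSemisimple ∧
    ∀ᶠ w in Filter.cofinite, ∀ α : Multiset ℂ, π.1.HasSatakeParamAt w α →
      ρ.IsUnramifiedAt w ∧ ρ.HasFrobCharpolyAt w (arithFrobPolyOfSatake ι w.residueCard n α)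

end Core

/-- **`TwistUnpackagingCore`**: the crux with the eight hypotheses the extraction never touches
DROPPED — `IsTotallyReal F₀`, the polarization datum `(e, k)` with `hpol`, `IsRegularAlgebraic`,
the parity clauses `hpar`/`hodd`, `ℓ ∤ disc F`, `π unramified above ℓ`. What remains: `[F:F₀] = 2`
with `τ ≠ 1`, `hnti` (only role: makes `ψ = 1` admissible), the controlled family, the conclusion.
`crux_of_core : Core → crux`, so no `_false_without_<H>` theorem exists for any of the eight (they
serve `HostInducedRep` and the glue-by-instantiation, not this crux). Provers: prove Core.
[folklore] -/
def TwistUnpackagingCore : Prop :=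
  ∀ (F₀ F : Type) [Field F₀] [NumberField F₀] [Field F] [NumberField F] [Algebra F₀ F]
    (τ : F ≃ₐ[F₀] F), Module.finrank F₀ F = 2 → τ ≠ 1 →
    ∀ (n : ℕ) (hcpt : isCompact_glFiniteIntegralLevel n F) (π : CuspidalAutomorphicRepData n F hcpt),
    (∃ᶠ w in Filter.cofinite, ∃ α β : Multiset ℂ,
      π.1.HasSatakeParamAt w α ∧ π.1.HasSatakeParamAt (τ • w) β ∧ β ≠ α) →
    ∀ (ℓ : ℕ) [Fact ℓ.Prime] (ι : PadicAlgCl ℓ ≃+* ℂ),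
    Family F₀ F τ n hcpt π ℓ ι → Conclusion F n hcpt π ℓ ι

/-- **Core ⇒ crux** (the eight dropped hypotheses are simply not passed on). [folklore] -/
theorem crux_of_core (h : TwistUnpackagingCore) : TwistUnpackaging :=
  fun F₀ F _ _ _ _ _ τ _ hdeg hτ n hcpt π _ _ _ _ _ _ hnti ℓ _ ι _ _ hfam =>
    h F₀ F τ hdeg hτ n hcpt π hnti ℓ ι hfam

/-! ## §2b The abstract form (reviewer's): Satake-type data instead of `π` -/

/-- **`AbstractTwistUnpackaging`** — the extraction over ABSTRACT a.e.-defined Satake-type data: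
a cofinite set `D` of finite places of `F` and `a : places → Multiset ℂ` with `card (a w) = n` on
`D`, in place of `π` (so the statement has NO automorphic content and is refutable in principle by
Galois-side junk data — none found: every hypothesis instance we can write down comes from a
genuine `ρ`, for which the conclusion holds). `core_of_abstract : Abstract → Core`. Provers aiming
at the crux should prove THIS (Taylor's virtual-character step + `separates_of` per place).
[folklore] -/
def AbstractTwistUnpackaging : Prop :=
  ∀ (F₀ F : Type) [Field F₀] [NumberField F₀] [Field F] [NumberField F] [Algebra F₀ F]
    (τ : F ≃ₐ[F₀] F), Module.finrank F₀ F = 2 → τ ≠ 1 →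
    ∀ (n : ℕ) (D : Set (HeightOneSpectrum (𝓞 F))) (a : HeightOneSpectrum (𝓞 F) → Multiset ℂ),
    Dᶜ.Finite → (∀ w ∈ D, Multiset.card (a w) = n) →
    (∃ᶠ w in Filter.cofinite, w ∈ D ∧ τ • w ∈ D ∧ a (τ • w) ≠ a w) →
    ∀ (ℓ : ℕ) [Fact ℓ.Prime] (ι : PadicAlgCl ℓ ≃+* ℂ),
    (∀ eψ : FramedGaloisRep F ℂ 1,
      (∀ w : HeightOneSpectrum (𝓞 F), ((ℓ : ℕ) : 𝓞 F) ∈ w.asIdeal → eψ.IsUnramifiedAt w) →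
      (∀ (φ : F →+* ℝ) (c c' : Field.absoluteGaloisGroup F), IsComplexConjugation φ c →
        IsComplexConjugation (φ.comp (τ : F →+* F)) c' →
        Matrix.GeneralLinearGroup.det (eψ c) = Matrix.GeneralLinearGroup.det (eψ c')) →
      (∃ᶠ w in Filter.cofinite, w ∈ D ∧ τ • w ∈ D ∧ ∃ c c' : ℂ,
        eψ.HasFrobCharpolyAt w (Polynomial.X - Polynomial.C c) ∧
        eψ.HasFrobCharpolyAt (τ • w) (Polynomial.X - Polynomial.C c') ∧
        (a (τ • w)).map (fun b ↦ b * c') ≠ (a w).map (fun x ↦ x * c)) →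
      ∃ R : FramedGaloisRep F₀ (PadicAlgCl ℓ) (2 * n), R.toGaloisRep.IsSemisimple ∧
        ∀ (v : HeightOneSpectrum (𝓞 F₀)) (c : _ → ℂ), ((ℓ : ℕ) : 𝓞 F₀) ∉ v.asIdeal →
          (∀ w : HeightOneSpectrum (𝓞 F), w.under (𝓞 F₀) = v →
            w.asIdeal.ramificationIdx (𝓞 F₀) = 1 ∧ w ∈ D ∧
            eψ.IsUnramifiedAt w ∧ eψ.HasFrobCharpolyAt w (Polynomial.X - Polynomial.C (c w))) →
          R.IsUnramifiedAt v ∧ R.HasFrobCharpolyAt v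
            (∏ᶠ w ∈ {w : HeightOneSpectrum (𝓞 F) | w.under (𝓞 F₀) = v},
              Polynomial.expand (PadicAlgCl ℓ) (w.asIdeal.inertiaDeg (𝓞 F₀))
                (arithFrobPolyOfSatake ι w.residueCard n ((a w).map (fun x ↦ x * c w))))) →
    ∃ ρ : FramedGaloisRep F (PadicAlgCl ℓ) n, ρ.toGaloisRep.IsSemisimple ∧
      ∀ᶠ w in Filter.cofinite, w ∈ D →
        ρ.IsUnramifiedAt w ∧ ρ.HasFrobCharpolyAt w (arithFrobPolyOfSatake ι w.residueCard n (a w))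

/-- **Abstract ⇒ Core.** Glue: `D := {w | π unramified at w}` (cofinite by the PROVED
`hasSatakeParamAt_cofinite_holds`), `a w :=` the Satake parameter at `w ∈ D` (well defined by the
PROVED `hasSatakeParamAt_unique_holds`), junk `0` off `D`. [folklore] -/
theorem core_of_abstract (h : AbstractTwistUnpackaging) : TwistUnpackagingCore := by
  intro F₀ F _ _ _ _ _ τ hdeg hτ n hcpt π hnti ℓ _ ι hfam
  classical
  -- the abstract data of `π`
  let D : Set (HeightOneSpectrum (𝓞 F)) := {w | π.1.IsUnramifiedAt w}
  let a : HeightOneSpectrum (𝓞 F) → Multiset ℂ :=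
    fun w => if hw : π.1.IsUnramifiedAt w then Classical.choose hw else 0
  have ha : ∀ {w}, π.1.IsUnramifiedAt w → π.1.HasSatakeParamAt w (a w) := by
    intro w hw
    simp only [a, dif_pos hw]
    exact Classical.choose_spec hw
  have huniq : ∀ {w α}, π.1.HasSatakeParamAt w α → a w = α := by
    intro w α hα
    exact AutomorphicRepData.hasSatakeParamAt_unique_holds π.1 (ha ⟨α, hα⟩) hα
  have hDc : Dᶜ.Finite := by
    have hcof : ∀ᶠ v in Filter.cofinite, π.1.IsUnramifiedAt v :=
      AutomorphicRepData.hasSatakeParamAt_cofinite_holds π.1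
    exact Filter.eventually_cofinite.1 hcof
  have hcard : ∀ w ∈ D, Multiset.card (a w) = n := fun w hw => (ha hw).card_eq
  have hnti' : ∃ᶠ w in Filter.cofinite, w ∈ D ∧ τ • w ∈ D ∧ a (τ • w) ≠ a w := by
    refine hnti.mono fun w ⟨α, β, hα, hβ, hne⟩ => ⟨⟨α, hα⟩, ⟨β, hβ⟩, ?_⟩
    rwa [huniq hα, huniq hβ]
  -- the abstract family hypothesis from the concrete one
  have hfam' : ∀ eψ : FramedGaloisRep F ℂ 1,
      (∀ w : HeightOneSpectrum (𝓞 F), ((ℓ : ℕ) : 𝓞 F) ∈ w.asIdeal → eψ.IsUnramifiedAt w) →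
      (∀ (φ : F →+* ℝ) (c c' : Field.absoluteGaloisGroup F), IsComplexConjugation φ c →
        IsComplexConjugation (φ.comp (τ : F →+* F)) c' →
        Matrix.GeneralLinearGroup.det (eψ c) = Matrix.GeneralLinearGroup.det (eψ c')) →
      (∃ᶠ w in Filter.cofinite, w ∈ D ∧ τ • w ∈ D ∧ ∃ c c' : ℂ,
        eψ.HasFrobCharpolyAt w (Polynomial.X - Polynomial.C c) ∧
        eψ.HasFrobCharpolyAt (τ • w) (Polynomial.X - Polynomial.C c') ∧
        (a (τ • w)).map (fun b ↦ b * c') ≠ (a w).map (fun x ↦ x * c)) →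
      ∃ R : FramedGaloisRep F₀ (PadicAlgCl ℓ) (2 * n), R.toGaloisRep.IsSemisimple ∧
        ∀ (v : HeightOneSpectrum (𝓞 F₀)) (c : _ → ℂ), ((ℓ : ℕ) : 𝓞 F₀) ∉ v.asIdeal →
          (∀ w : HeightOneSpectrum (𝓞 F), w.under (𝓞 F₀) = v →
            w.asIdeal.ramificationIdx (𝓞 F₀) = 1 ∧ w ∈ D ∧
            eψ.IsUnramifiedAt w ∧ eψ.HasFrobCharpolyAt w (Polynomial.X - Polynomial.C (c w))) →
          R.IsUnramifiedAt v ∧ R.HasFrobCharpolyAt v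
            (∏ᶠ w ∈ {w : HeightOneSpectrum (𝓞 F) | w.under (𝓞 F₀) = v},
              Polynomial.expand (PadicAlgCl ℓ) (w.asIdeal.inertiaDeg (𝓞 F₀))
                (arithFrobPolyOfSatake ι w.residueCard n ((a w).map (fun x ↦ x * c w)))) := by
    intro eψ h₁ h₂ h₃
    obtain ⟨R, hRss, hR⟩ := hfam eψ h₁ h₂ (h₃.mono fun w ⟨hw, hτw, c, c', hc, hc', hne⟩ =>
      ⟨a w, a (τ • w), c, c', ha hw, ha hτw, hc, hc', hne⟩)
    refine ⟨R, hRss, fun v c hv hgood => hR v a c hv fun w hw => ?_⟩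
    obtain ⟨he, hwD, hu, hc⟩ := hgood w hw
    exact ⟨he, ha hwD, hu, hc⟩
  obtain ⟨ρ, hρss, hρ⟩ := h F₀ F τ hdeg hτ n D a hDc hcard hnti' ℓ ι hfam'
  refine ⟨ρ, hρss, hρ.mono fun w hw α hα => ?_⟩
  obtain ⟨hu, hP⟩ := hw ⟨α, hα⟩
  exact ⟨hu, huniq hα ▸ hP⟩

/-! ## §2c The family hypothesis is not vacuous: `ψ = 1` is admissible -/

/-- **`ψ = 1` is admissible under `hnti`.** The trivial Artin avatar is unramified everywhere, has
equal (trivial) signs at `w` and `τw`, and its twisted Satake data is the untwisted one, so the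
robust non-`τ`-invariance premise is exactly `hnti`. Hence `hfam` really delivers `R_1` (with
`R_1|Γ_F ≅ ρ ⊕ ρ^τ` in the intended model) and the crux is not vacuously true through an empty
family. [folklore] -/
theorem trivialTwist_admissible {F₀ F : Type} [Field F₀] [NumberField F₀] [Field F] [NumberField F]
    [Algebra F₀ F] (τ : F ≃ₐ[F₀] F) {n : ℕ} {hcpt : isCompact_glFiniteIntegralLevel n F}
    (π : CuspidalAutomorphicRepData n F hcpt) (ℓ : ℕ)
    (hnti : ∃ᶠ w in Filter.cofinite, ∃ α β : Multiset ℂ,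
      π.1.HasSatakeParamAt w α ∧ π.1.HasSatakeParamAt (τ • w) β ∧ β ≠ α) :
    (∀ w : HeightOneSpectrum (𝓞 F), ((ℓ : ℕ) : 𝓞 F) ∈ w.asIdeal →
      (1 : FramedGaloisRep F ℂ 1).IsUnramifiedAt w) ∧
    (∀ (φ : F →+* ℝ) (c c' : Field.absoluteGaloisGroup F), IsComplexConjugation φ c →
      IsComplexConjugation (φ.comp (τ : F →+* F)) c' →
      Matrix.GeneralLinearGroup.det ((1 : FramedGaloisRep F ℂ 1) c) =
        Matrix.GeneralLinearGroup.det ((1 : FramedGaloisRep F ℂ 1) c')) ∧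
    (∃ᶠ w in Filter.cofinite, ∃ (α β : Multiset ℂ) (c c' : ℂ), π.1.HasSatakeParamAt w α ∧
      π.1.HasSatakeParamAt (τ • w) β ∧
      (1 : FramedGaloisRep F ℂ 1).HasFrobCharpolyAt w (Polynomial.X - Polynomial.C c) ∧
      (1 : FramedGaloisRep F ℂ 1).HasFrobCharpolyAt (τ • w) (Polynomial.X - Polynomial.C c') ∧
      β.map (fun b ↦ b * c') ≠ α.map (fun a ↦ a * c)) := by
  have hfrob : ∀ w : HeightOneSpectrum (𝓞 F),
      (1 : FramedGaloisRep F ℂ 1).HasFrobCharpolyAt w (Polynomial.X - Polynomial.C 1) := by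
    intro w 𝔓 _ σ _
    simp [FramedRep.charpoly, Matrix.charpoly_one]
  refine ⟨fun w _ 𝔓 _ σ _ => rfl, fun φ c c' _ _ => rfl, ?_⟩
  refine hnti.mono fun w ⟨α, β, hα, hβ, hne⟩ => ⟨α, β, 1, 1, hα, hβ, hfrob w, hfrob (τ • w), ?_⟩
  simpa using hne

/-! ## §6 NEW in cycle 3 — Negative IV and V (LANDED, imported above)

* Negative IV `…Theorems.TwistUnpackaging.Negative.ExponentBoundedFamily` (p70982, commit 824f4f807396):
  `SeparatesFamily`, `SeparatesFamily.mono`, `separatesFamily_of_mem`, `separates_iff_separatesFamily_pair`,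
  `orbit_val_map_pow_mul`, `orbit_swap_powers`, `not_separatesFamily_powers`,
  `not_separatesFamily_rootsOfUnity`, `separatesFamily_insert`.
* Negative V `…Theorems.TwistUnpackaging.Negative.DetRescueBoundary` (p71082, commit 6e2e63bd8c32):
  `DetRescue`, `odd_part_eq`, `det_rescue_rank_three`, `detRescue_three`, `rank_four_symmetric_swap`,
  `not_detRescue_of_four_le`, `not_detRescue_four`, `pure_uv`, `norm_pureU`, `norm_pureV`,
  `rank_four_pure_swap`, `not_detRescue_four_pure`.
The re-statements below pin the two headline facts inside this file (proofs by reference). -/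

section CycleThree

/-- §6a headline (Negative IV): for `1 ≤ d ≤ n` the whole group `μ_d` of ratios is fooled at once —
families of exponent `≤ n` never close the cofinite step in rank `n`. [folklore] -/
theorem boundedExponent_blind {n d : ℕ} (hd : 0 < d) (hle : d ≤ n) :
    ¬ SeparatesFamily n {u : ℂ | u ^ d = 1} :=
  not_separatesFamily_rootsOfUnity hd hle

/-- §6b headline (Negative V): the Berger–Harcos determinant rescue holds in rank `3` and fails from
rank `4` on. [folklore] -/
theorem detRescue_boundary : DetRescue 3 ∧ ∀ n, 4 ≤ n → ¬ DetRescue n :=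
  ⟨detRescue_three, fun _ hn => not_detRescue_of_four_le hn⟩

/-- §6c headline (Negative VI): the determinant rescue works EXACTLY in ranks `≤ 3`. [folklore] -/
theorem detRescue_classification (n : ℕ) : DetRescue n ↔ n ≤ 3 := detRescue_iff

/-- §6d headline (Negative VII): the ideator's `CyclicTwistUnscrewing` is false as typed (`χ = 1`
admitted; `S₃` witness). Repair: `χ` of exact order `p`. [folklore] -/
theorem cyclicTwistUnscrewing_asTyped_false : ¬ CyclicTwistUnscrewingAsTyped :=
  cyclicTwistUnscrewingAsTyped_false

end CycleThree

/-! ## §10 NEW in cycle 4 — TARGETS: the six stubs of the registered skeleton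
`Lines/kummer-chebotarev-separating-twists.lean` (sha `e396fa773a0d`, planner crux-plan round 1)

The skeleton derives the crux from `stub_separatingTwists` (A), `stub_admissiblePowers` (B),
`stub_packageDictionary` (C), `stub_cyclicUnscrewing` (D), `stub_finiteCandidateGluing` (E),
`stub_assembly` (F); the composition `TwistUnpackaging_of` is kernel-checked. Attacked here:
rank-0 / `d = 0` instantiation of every stub, junk models, typing conventions, decoupling and
small-group shadows of the engine D. Outcome: B KILLED (misstated, rank 0), A C D E F survive. -/

section CycleFour

/-- §10a headline (Negative VIII(b)): **stub B is false as typed.**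
`Literature.Uncategorized.StubAdmissiblePowers` is the verbatim stub (relocated there by the gate); the kill instantiates `n = 0` (a cuspidal datum of `GL_0` exists and every Satake
parameter is `∅`, so the stub's conclusion says `{1,…,p-1} ⊆ {j₀}`) at the coherent cubic family of
§10b. CLASS stub-misstated; REPAIR `0 < n` (in `TwistUnpackaging_of`:
`have hn : 0 < n := Nat.pos_of_ne_zero (by rintro rfl; exact notTauInvariant_rank_zero_false τ π hnti)`);
the stub is TRUE for `n ≥ 1` (two failing exponents `j ≠ j'` force `Sat(π,w) = Sat(π,w)·r_w^{j'-j}`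
a.e., `r_w = c w / c (τ•w) ∈ μ_p`, hence `r_w = 1` a.e. by `0 ∉ Sat`, `0 < n < p` — contradicting
Chebotarev for the ratio character `e₁^t/e₁ ≠ 1` witnessed by `w₀`). [folklore] -/
theorem stubB_false : ¬ Literature.Uncategorized.StubAdmissiblePowers := stubAdmissiblePowers_false

/-- §10a': the GL_0 cuspidal datum behind the kill (every stub over `π : CuspidalAutomorphicRepData
n F hcpt` without `0 < n`/`hnti` must survive `n = 0`, where Satake parameters are empty).
[folklore] -/
theorem rank_zero_datum (K : Type) [Field K] [NumberField K]
    (hcpt : isCompact_glFiniteIntegralLevel 0 K) : Nonempty (CuspidalAutomorphicRepData 0 K hcpt) :=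
  nonempty_cuspidalAutomorphicRepData_zero K hcpt

/-- §10b headline (Negative VIII(a)): **a coherent cubic family which is not `τ`-invariant exists**
(`ℚ(ζ₃)/ℚ`, Kummer character of `∛2`, `e j = χʲ ∘ r`, `c = χ ∘ Frob`, `Q` = ramified primes).
Besides killing B it is the simplest honest instance of the line's LEVER (stub A's output for
`T = {w₀}`, `p = 3`): ideators may import it as a test object. [folklore] -/
theorem coherentCubicFamily :
    ∃ (F : Type) (_ : Field F) (_ : NumberField F) (_ : Algebra ℚ F) (τ : F ≃ₐ[ℚ] F),
      Module.finrank ℚ F = 2 ∧ τ ≠ 1 ∧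
      ∃ (Q : Set (HeightOneSpectrum (𝓞 F))) (c : HeightOneSpectrum (𝓞 F) → ℂ)
        (e : ℕ → FramedGaloisRep F ℂ 1),
        Q.Finite ∧ (∀ v ∉ Q, c v ^ 3 = 1) ∧
        (∀ j : ℕ, ∀ v ∉ Q, (e j).HasFrobCharpolyAt v (Polynomial.X - Polynomial.C (c v ^ j))) ∧
        ∃ w₀, w₀ ∉ Q ∧ τ • w₀ ∉ Q ∧ c (τ • w₀) ≠ c w₀ :=
  exists_coherentFamily_not_tauInvariant

/-! ### §10c Paper verdicts on the surviving stubs (no Lean object; the reasoning is the content)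

* **A `stub_separatingTwists` — TRUE (CFT supply), unrefutable cheaply (`∃`-conclusion).**
  Kummer–Chebotarev: `p ∤ h_F`, `p > m`; `x_w` a generator of `(𝔭_w 𝔭_{τw}⁻¹)^{h_F}` for the pairs
  `{w, τw} ⊆ T`; valuations (`v_w(x_w) = h_F`, `p ∤ h_F`, ramification in `F(ζ_p)/F` of degree
  `∣ p-1`) make the `x_w` independent in `F(ζ_p)^×/(p-th powers · units)`; Chebotarev in
  `F(ζ_{p²}, U^{1/p}, x_w^{1/p})` gives a prime `q ∉ S ∪ T ∪ τT` with `Cl_q(F)[p^∞] ≅ ℤ/p` on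
  which every `[𝔭_w] - [𝔭_{τw}]` is non-zero; `ψ` = the order-`p` character of `Cl_q(F)`,
  `Q = {q}`, parity automatic (`p` odd). The coherent cubic family of §10b is the case `T = {w₀}`,
  `p = 3` in the flesh (with `Q` = primes over `6`).
* **C `stub_packageDictionary` — TRUE; conventions verified.** `roots (arithFrobPolyOfSatake ι q m
  (α.map (· * c))) = (roots …α).map (· * (ι.symm c)⁻¹)` (from `roots_arithFrobPolyOfSatake`: roots
  are `ι⁻¹((√q)^{m-1} a)⁻¹`), matching the stub's `(ι.symm (c w))⁻¹`; split `v`: fibre `{w, τw}`,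
  `f = 1`, `R|_{Γ_F}(Frob_w) = R(Frob_v)`; inert `v`: `charpoly R(Frob_v) = P_w(X²)` so
  `R(Frob_w) = R(Frob_v)²` has roots `2 · roots P_w` = the stub's RHS with `τ • w = w`; rank 0 fine
  (`charpoly` of a `0 × 0` matrix is `1`, `arithFrobPolyOfSatake … 0 = 1`). Needs `0 ∉ Sat`
  (`hasSatakeParamAt_ne_zero`, true for data: `e_n(α)` is the eigenvalue of a central translation).
* **D `stub_cyclicUnscrewing` (engine) — SURVIVES; no small counter-model.** Pure Galois side, so
  refutable in principle. (i) `d = 0` trivial. (ii) `d = 1` TRUE in general: `A` irreducible forces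
  `C'_j ≅ A ⊗ u^{i_j}` (Clifford at prime index `p > 16`), whose root pattern `{u^i X, u^i Y}` can
  equal `{X, u^j Y}` for at most one `j ≠ 0`; `A = χ₁ ⊕ χ₂` is handled by the abelian count.
  (iii) DECOUPLING FAILS: one cannot keep the `C_j` (`j ≠ 0`) of a genuine `ρ₀` and replace
  `A = C_0` by a different `θ`-invariant rep with the same charpolys on `Γ_F ∖ ker u` — a virtual
  character with `≤ 4d < p` constituents supported on `ker u` is `u`-twist-stable, and twist orbits
  of irreducibles of dimension `< p` have size `p`, so it vanishes: `A` IS determined by its data off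
  `ker u`. (iv) TAME SHADOW `D = H × ℤ/p`, `p ∤ |H|`: TRUE by TAG RECOVERY — a value `λ ζ^{sk}`
  (`λ ∈ μ_{|H|}`, `k ≠ 0`) determines `(λ, s)`; the tagged choice `M(h,k)` behind `X` is
  `k`-independent (a non-empty `shift_j`-stable tag set has `≥ p > d` elements) and its `s`-part is
  the `ζ^s`-isotypic `H`-representation of `C'_j` for generic `j`, hence genuine; so `X` comes from
  a representation `ρ` and `A ≅ ρ ⊕ ρ^θ` by (iii). PROVER HINT: (iii)+(iv) are a proof strategy
  (eigenvalue tags instead of `Bad(A)` counting) whenever the `p`-part of the image is split; the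
  only untested regime is `p ∣ |image of H|` / wild actions — a `kit gap` search there needs groups
  of order `≥ 17·|H|` with faithful small representations and is not cheap. MUTATION: `0 ∉ S w` is
  REDUNDANT (roots of the characteristic polynomial of an invertible matrix are non-zero, read off
  `j = 0 ∈ J` at `w ∉ E`); `card (S w) = d` is load-bearing (it is the rank of the conclusion's `ρ`);
  `E.Finite` is load-bearing (with `E` cofinite the data constrain two Frobenius classes only and a
  `θ`-invariant but non-`θ`-split `C 0` survives them — no cheap formal witness: it needs an honest
  irreducible Galois representation with controlled Frobenius at one place); the non-triviality
  `∃ w₀, c (τ • w₀) ≠ c w₀` is load-bearing (Negative VII, `χ = 1`).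
* **E `stub_finiteCandidateGluing` — TRUE.** Brauer–Nesbitt makes every `τ`-halving a sub-sum of
  the constituents of `A`: finitely many charpoly-functions `f₁,…,f_N`; if each `f_i` fails at some
  `w_i ∈ G`, the finite batch `T = {w₁,…,w_N}` has no halving — contradiction (`N = 0` is excluded by
  the hypothesis at `T = ∅`). `d = 0` fine.
* **F `stub_assembly` — TRUE.** `A ≅ ρ ⊕ ρ^θ` (Brauer–Nesbitt) makes `ρ` unramified where `A` is;
  split `w`: monic degree-`n` charpoly with the `n` prescribed roots; inert `w`: `θ_t σ` is again an
  arithmetic Frobenius above `τ • w = w` (`isArithFrobAt_absGaloisOuterConj_iff`), so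
  `roots ρ(θσ) = roots ρ(σ)` and `inert_halving` applies; uniqueness of Satake parameters. `n = 0`
  fine. -/

end CycleFour


/-! ## §7 Attack log (cycles 1–3) and WHY IT RESISTS

Cycle 1 (gen 1, 7 attacks) and cycle 2 (gen 2, 14 attacks) — reconstructed from the item's evidence
notes: elaboration probe rc0 (rev 3 served); target ⇒ crux (§0); Core mutation of the 8 decorative
hypotheses (§2); `n = 0` vacuity (§1); family non-vacuity via `ψ = 1` (§2c); junk hunt on
`HasFrobCharpolyAt` / `arithFrobPolyOfSatake` (m = n, ℕ-subtraction bites only at n = 0) / `∏ᶠ` over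
the primes above `v` (finite, degree `2n`) / `Polynomial.expand` by `inertiaDeg` / `ι`; per-place
separation settled in all ranks (Negative I); two-twist and inert variants; control load-bearing
(Negative II, III); Berger–Harcos §6 / Mok 5.13 literature anchor (rank-2 det rescue); `S₅ > A₅` GAP
toy for the global step (twist SUPPLY load-bearing; gen-2 job j006854, hand-verified: `A₅` characters
are real on `5A`, the mixed datum has trace `1 + ζ₅ + ζ₅²`).

Cycle 3 (gen 3, this file):
15. EXPONENT-BOUNDED FAMILIES (§6a). Strengthening "the admissible family may be cut down to
    characters of exponent `d`" is FALSE in the shadow for every `d ≤ n` (`orbit_swap_powers`: the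
    whole group `μ_d` of ratios is fooled at once; `not_separatesFamily_rootsOfUnity`). The crux
    survives because admissible `ψ` of every odd prime order exist (parity automatic) — but any proof
    must actually USE ratio order `> n` at the place (cards kummer-*, prime-order-cyclic-unscrewing do).
16. DETERMINANT-RESCUE BOUNDARY (§6b). The printed `n = 2` device (quadratic twists + central
    character) extends to rank 3 (`det_rescue_rank_three`) and FAILS from rank 4 (`not_detRescue_of_four_le`,
    pure witness `not_detRescue_four_pure`). Irrelevant to the crux as typed (no determinant datum in
    `hfam`), fatal for any plan to imitate Berger–Harcos beyond rank 3.
17. TYPING RE-AUDIT on this pin (imports above): `FramedGaloisRep.HasFrobCharpolyAt v P ρ` = every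
    arithmetic Frobenius at every prime above `v` has charpoly `P` — unsatisfiable at ramified `v`
    (so the `hpol`/control premises are vacuous exactly at the finitely many bad places, harmless),
    unique at unramified `v` (`HasFrobCharpolyAt.unique_holds`); `FramedGaloisRep F ℂ 1` is a
    continuous hom (finite image); `IsOdd` is vacuous for totally complex `F` (only weakens `hodd`,
    a hypothesis). No junk handle on the conclusion: it quantifies over genuine `FramedGaloisRep`.
18. THE TOTALLY REAL SUB-CASE. The crux allows `F/F₀` BOTH totally real (e.g. `ℚ(√2)/ℚ`), where the
    route's justification "⋂_ψ ker(ψ^τ/ψ) cuts out an infinite extension because F has a complex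
    place" does not apply verbatim. Checked on paper: the index is infinite for EVERY quadratic
    `F/F₀` — `[Γ_F : ⋂ ker χ_ψ] = |(1 - τ)Γ_F^{ab}|`, and ray-class characters `ψ` of odd prime order
    with conductor a single split prime `w ∤ ℓ` (`ψ^τ` has conductor `τw ≠ w`) give infinitely many
    distinct `χ_ψ` (admissible: unramified above `ℓ`, parity automatic, robustly non-τ-invariant off
    finitely many cosets). So no refutation from the totally real regime; NOTE FOR PROVERS: do not
    assume a complex place, the Kummer/ray-class supply argument is signature-free.
19. FINITE SUB-FAMILIES. Any FINITE set of admissible twists is blind at the infinitely many places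
    split completely in the compositum of their ratio kernel fields (all ratios `1` there:
    `not_separates_one`); the proof must draw a place-dependent member from the infinite family
    (this is the `∀ v ∃ i` shape of `extractionWithControl_holds`). Consistent with the crux.
21. IDEA-LEMMA KILL (Negative VII, p71612). `Sketch.CyclicTwistUnscrewing` (ideator 1) as typed
    admits `χ = 1`; witness `Γ = S₃`, `k = ℂ`, `d = 1`, `p = 17`, `C_j = std`: rank-1 `ρ_i` kill
    the commutator 3-cycle, `(X-1)² ≠ X²+X+1`. Formalised (`cyclicTwistUnscrewingAsTyped_false`,
    standard representation built over `ℤ` with `decide`d hom/det/trace, Maschke instance for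
    semisimplicity). Repair `orderOf χ = p`; the other two Sketch lemmas (`FiniteCandidateGluing`,
    `KummerDescentDetection`) survive inspection (the first is true as typed: characters determine
    semisimple representations in characteristic 0, finitely many candidate halves, finite
    intersection property).
20. POWER MAPS. Frobenius-power coherence (`P(Frob²)` vs `P(Frob)²`), which detects the `S₅ > A₅`
    mixed datum in the finite toy, is NOT available in the crux (a Frobenius power is not a
    Frobenius); the genuine global step must come from Taylor's virtual characters with infinite
    twist supply (attack 18 guarantees the supply). No handle for a refutation.

Cycle 4 (gen 4, this file; targets = the six stubs of skeleton `e396fa773a0d`):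
22. RANK-0 SWEEP of all six stubs: only B breaks (Satake `∅` makes its conclusion `{1..p-1} ⊆ {j₀}`);
    C, E, F hold at `n = 0`/`d = 0` (`charpoly` of `0×0` is `1`, empty products), D trivial at
    `d = 0`, A rank-free.
23. GL_0 DATUM: `CuspidalAutomorphicRepData 0 F hcpt` is INHABITED (Lean: Dirac measure +
    `nonempty_cuspidalAutomorphicRepGL_zero` + PROVED `exists_cuspidalRepData_of_L2_holds`) — so
    "vacuous at n = 0" is NOT available to any stub that drops `hnti`/`0 < n`.
24. KILL of B (Negative VIII): reduction `StubB → CoherentFamiliesTauInvariant` (rank 0) and the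
    Kummer witness `¬ CoherentFamiliesTauInvariant` — conjugation lemma via `AbsGaloisOuterConj`,
    Frobenius density (`frobenius_dense`, `chebotarev_artinRep_holds`), fixed field of `Γ_F`,
    `2`-adic valuation of a would-be rational `∛4`. Axioms standard.
25. CONVENTION AUDIT of C against `roots_arithFrobPolyOfSatake` (inverse twist factor is right;
    inert/split Frobenius bookkeeping consistent with `HasFrobCharpolyAt` = all arithmetic Frobenii).
26. ENGINE D: decoupling attack (fails by the twist-orbit argument), full `d = 1` analysis (true),
    tame shadow `H × ℤ/p` (true by tag recovery) — see §10c; no cheap counter-model exists in the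
    split regime.
27. E and F: compactness / inert-transport arguments written out (true).

WHY IT RESISTS (unchanged, sharpened): (i) the crux is `X ∧ hfam ⇒ concl(X)`, so `¬crux ⇒ ¬X ⇒
¬(A)` for a genuine `π` — out of reach by design; (ii) every shadow in which something fails
(uncontrolled sets, bounded exponent, det rescue ≥ 4, finite supply) removes a feature the rev-3
statement HAS (control at the place, unbounded admissible orders, infinite supply); (iii) the
interface offers no junk inhabitant on the conclusion side.

## §8 Next regimes (cycle 5+)
* (done, cycle 4) targets swept; B killed (Negative VIII landed, imported); tell-tale for the lead:
  add `0 < n` to stub B and re-register the skeleton (the composition needs one extra line);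
* toy shadows of the engine D (`toyD/engine_cyclic_shadow.py`, `engine_rank2_shadow.py`, local smoke
  runs: cyclic shadow `D = ℤ/p`, `H = 1`, `p ≤ 7`, `d ≤ 2` — no counter-example even for `p ≤ d²`;
  `(ℤ/3)²` shadow, `d = 1`, three involutions — none; full sweep resubmitted as kit job j013817
  (j009514 died on a wrong entry point, exit 127) — results attach to the item automatically);
* if the lead gets stuck on D: offer the TAG-RECOVERY route of §10c (iii)+(iv) as a consult nudge,
  and run the `p ∣ |H|` GAP toy (smallest: `H = ℤ/17`, `D = ℤ/17 × ℤ/17` with `θ = (x,k) ↦ (-x+vk,-k)`,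
  `d = 1` is settled, so `d = 2`, `p = 67`: `D = (ℤ/67)²`, reps = characters, search over tagged
  selections modulo the structural reductions) only if a concrete doubt appears;
* (done) Negative IV–VII landed and imported;
* the REPAIRED `CyclicTwistUnscrewing` (`orderOf χ = p`): checked true on paper for `Γ = ℤ/p`,
  `d = 1` (mixing detected by every `j ≠ 0`); a finite-group search (`kit gap`) over `Γ` with a
  normal subgroup of prime index `p > 16d²`, `d = 1, 2`, is the natural next toy if that line is picked;
* targets: none yet (no line picked, `stuck_stubs = []`); when a skeleton registers, attack its stubs
  first — predicted weak points: (a) any stub asserting separation from twists of bounded order or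
  from finitely many twists (killed by §6a / attack 19); (b) any stub using a determinant/central
  character beyond rank 3 (killed by §6b); (c) any stub that needs a complex place of `F` (attack 18
  says it should not — ask for the signature-free form); (d) `CyclicTwistUnscrewing` as typed in the
  ideator Sketch allows `χ = 1` (triage r1-3: stub-misstated, witness `S₃`, `p = 17`);
* global-step toy in Lean (virtual-character bookkeeping over an abstract group with an index-2
  subgroup: ψ-independence of `θ_ψ = (tr B_ψ - ψ^τ tr A)/(ψ - ψ^τ)` on `Δ ∖ ker χ_ψ ∩ ker χ_ψ'`);
* literature: Taylor 1994 §3 (doi:10.1007/bf01231575, WANTED by rattack) — read when fulfilled and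
  anchor exactly which density statement it proves (expected: Dirichlet density one, uncontrolled).

## §9 HANDOFF (gen 4)
Landed: Negative I–III (gen 2); IV ExponentBoundedFamily (p70982), V DetRescueBoundary (p71082),
VI DetRescueClassification (p71371), VII CyclicTwistUnscrewingFalse (p71612) (gen 3);
VIII(a) CoherentCubicFamily (p72809), VIII(b) StubAdmissiblePowersFalse (p73706; shadow defs p73705) (gen 4).
Pending: nothing. Sorried: nothing. Targets: 6 stubs of skeleton `e396fa773a0d`; BROKEN: 1
(`stub_admissiblePowers`, misstated, repair `0 < n`); surviving: A, C, D, E, F (§10c). Next: §8.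
-/

end Summit.Langlands.Langlands.Cruxes.TwistUnpackaging.Disproof
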